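import Literature.NumberTheory.Transcendental.SemistableTorsion
import HarnessLib

/-!
# The analytic subgroup theorem for `𝔾ₐ × 𝔾ₘ^ι × (E♮)^κ` from the hyperplane case of the Semistability Theorem

Topic `Literature/NumberTheory/Transcendental`; a proofs-only file (theorems only, no named
facts) refining the reduction of the named fact
`Literature.NumberTheory.Transcendental.analyticSubgroupTheorem_GaGmE`
(`AnalyticSubgroupElliptic.lean`; unit `provefact-…a-b3a2d199ff`).

The tree proves `analyticSubgroupTheorem_GaGmE` from the named fact `semistabilityTheorem_std`
(Baker–Wüstholz's Semistability Theorem, Thm. 6.15, for the explicit group varieties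
`M_κ = 𝔾ₘ^β × P_κ`, for ALL proper semistable `𝔟` and ALL algebraic points;
`analyticSubgroupTheorem_GaGmE_of_std`, `SemistableQuotients.lean`). But
`analyticSubgroupTheorem_GaGmE` is a statement about a `ℚ̄`-**hyperplane** (a linear relation
among the coordinates of `u`), and the hyperplane dévissage
`LiePresentation.linearIndependent_of_hyperplaneTheorem` of `SemistableTorsion.lean` (run there in
the torsion-restricted presentation `GaGmE.presTors`) works verbatim in the unrestricted
presentation `GaGmE.pres`. Hence **Thm. 6.15 for `M_κ` is needed only for hyperplanes `W`
containing no non-zero algebraic Lie subalgebra — but at all algebraic points**: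

* `GaGmE.hyperplaneTheorem_pres_of_std_hyperplane` — transport: that hyperplane statement for
  the `M_κ` (spelled out as the hypothesis `hstd`; it is the hyperplane statement `hstd` of
  `SemistableTorsion.lean` with `Std.AlgTors` replaced by `Std.Alg`) gives
  `(GaGmE.pres L ι κ h₂ h₃).HyperplaneTheorem` (same proof as
  `GaGmE.hyperplaneTheorem_presTors_of_std_tors`, with `QuotData.Φ_mem_Alg`);
* `analyticSubgroupTheorem_GaGmE_of_hyperplaneTheorem` — the dévissage in `GaGmE.pres`
  (`GaGmE.SubgroupData.tangent_eq_top_of_mem` + `linearIndependent_of_hyperplaneTheorem`);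
* `analyticSubgroupTheorem_GaGmE_of_std_hyperplane` — the composite;
* `semistabilityTheorem_std.hyperplane` — the hyperplane statement is implied by the unrestricted
  named fact (a hyperplane without algebraic Lie subalgebras is proper and semistable,
  `GaGmE.Std.ne_top_of_hyperplane`, `GaGmE.Std.semistable_of_hyperplane`), so nothing stronger
  than the existing reduction is assumed.

Why this matters for a Baker-method discharge (op. cit. §6.8, pp. 116–119; Philippon–Waldschmidt
1988): for a hyperplane `W` the obstruction subgroup `G'` of the zero estimate either has
`Lie G' ⊆ W`, hence `G' = 0`, or has `codim_W(W ∩ Lie G')` maximal, and no borderline closing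
argument is needed (see the module docstring of `SemistableTorsion.lean`, (ii)); what remains,
compared with the torsion-restricted chain of the seven 1-periods, is the arithmetic of the points
`s·exp(u/ℓ)` for NON-torsion `E`-coordinates (division points and heights:
`EllipticCurves/WeierstrassPMultiplication.lean`, `WeierstrassSigmaDivision.lean`,
`Transcendental/UnivExtAlgPointsDivision.lean`, `EllipticCurves/HeightsMultiples.lean`). The
hypothesis `hstd` below is NOT vendored as a named fact (D-0026): it is an explicit hypothesis,
implied by `semistabilityTheorem_std`.

## References

* A. Baker, G. Wüstholz, *Logarithmic Forms and Diophantine Geometry*, CUP 2007: Thm. 6.1,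
  §6.7, Thm. 6.15, §6.8 (p. 115: passage to the quotient; Thm. 6.1 from Thm. 6.15).
  [BakerWustholz2007]
* A. Huber, G. Wüstholz, *Transcendence and Linear Relations of 1-Periods*, CUP 2022, Thm. 6.2
  (proof via the torsion points `u/n`). [HuberWustholz2022]
* P. Philippon, M. Waldschmidt, *Formes linéaires de logarithmes sur les groupes algébriques
  commutatifs*, Illinois J. Math. 32 (1988), Thm. 2.1, §8 (Lemme 8.1).
-/

noncomputable section

open Complex Module Submodule

namespace Literature.NumberTheory.Transcendental

namespace GaGmE

section Transport

variable {ι κ : Type} [Fintype ι] [Fintype κ]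

/-- **Transport (hyperplane form, all algebraic points).** The Semistability Theorem for the
explicit groups `M_κ`, for `ℚ̄`-hyperplanes `W` of `Lie M_κ` containing no non-zero algebraic
Lie subalgebra and at ALL algebraic points (hypothesis `hstd`), implies the hyperplane theorem
for the quotients `G/H` of `G = 𝔾ₐ × 𝔾ₘ^ι × (E♮)^κ`, i.e. `(pres L ι κ h₂ h₃).HyperplaneTheorem`.
Same transport as `hyperplaneTheorem_presTors_of_std_tors` (adapted coordinates
`Φ : Lie G → Lie M_κ` of `QuotData`; `Φ(W)` is a `ℚ̄`-rational hyperplane; algebraic subgroups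
pull back; algebraic points map to algebraic points, `QuotData.Φ_mem_Alg`; the kernel lifts,
`QuotData.exists_ker_of_Φ_mem_ker`). [cite: BakerWustholz2007, §6.8 (p. 115: passage to the quotient `G → G^*`)] -/
theorem hyperplaneTheorem_pres_of_std_hyperplane
    (hstd : ∀ (L : PeriodPair), IsAlgebraic ℚ L.g₂ → IsAlgebraic ℚ L.g₃ → ¬ L.HasCM →
      ∀ (β γ δ : Type) [Fintype β] [Fintype γ] [Fintype δ] (κM : δ → γ → Kbar)
        (W : Submodule ℂ (β ⊕ (γ ⊕ δ) → ℂ)), LiePresentation.IsKRational Kbar W →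
        finrank ℂ W + 1 = Fintype.card (β ⊕ (γ ⊕ δ)) →
        (∀ 𝔨 ∈ Std.algLie κM, 𝔨 ≤ W → 𝔨 = ⊥) →
        ∀ w ∈ W, w ∈ Std.Alg L κM → w ∈ Std.ker L κM)
    (L : PeriodPair) (h₂ : IsAlgebraic ℚ L.g₂) (h₃ : IsAlgebraic ℚ L.g₃) (hCM : ¬ L.HasCM)
    (ι κ : Type) [Fintype ι] [Fintype κ] : (pres L ι κ h₂ h₃).HyperplaneTheorem := by
  refine ⟨?_⟩
  rintro _ ⟨D₀, rfl⟩ W hWrat h𝔥W hWdim hmax w hwW hwAlg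
  classical
  obtain ⟨Q⟩ := nonempty_quotData D₀
  set W' : Submodule ℂ (Q.σ' → ℂ) := W.map Q.Φ with hW'
  have hcomapW : W'.comap Q.Φ = W := Q.comap_map h𝔥W
  -- (T1) rationality
  have h1 : LiePresentation.IsKRational Kbar W' := Q.isKRational_map hWrat
  -- (T2) `Φ(W)` is a hyperplane
  set h : ℕ := finrank ℂ ↥D₀.tangent
  have hdimW : finrank ℂ W = finrank ℂ W' + h := by rw [← hcomapW]; exact Q.finrank_comap W'
  have hcard : Fintype.card (Unit ⊕ (ι ⊕ (κ ⊕ κ))) = Fintype.card Q.σ' + h := by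
    have e1 : finrank ℂ ↥((⊤ : Submodule ℂ (Q.σ' → ℂ)).comap Q.Φ) =
        finrank ℂ (⊤ : Submodule ℂ (Q.σ' → ℂ)) + h := Q.finrank_comap ⊤
    rw [Submodule.comap_top, finrank_top, finrank_top, Module.finrank_fintype_fun_eq_card,
      Module.finrank_fintype_fun_eq_card] at e1
    exact e1
  have h2 : finrank ℂ W' + 1 = Fintype.card Q.σ' := by
    change finrank ℂ ↥W + 1 = Fintype.card (Unit ⊕ (ι ⊕ (κ ⊕ κ))) at hWdim
    omega
  -- (T3) no non-zero algebraic Lie subalgebra inside `Φ(W)`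
  have h3 : ∀ 𝔨' ∈ Std.algLie Q.κM, 𝔨' ≤ W' → 𝔨' = ⊥ := by
    rintro _ ⟨D', rfl⟩ hle
    have hpullW : (Q.pull D').tangent ≤ W := by
      rw [← Q.comap_tangent, ← hcomapW]
      exact Submodule.comap_mono hle
    have heq : (Q.pull D').tangent = D₀.tangent :=
      hmax (Q.pull D').tangent ⟨Q.pull D', rfl⟩ (Q.tangent_le_pull D') hpullW
    apply Submodule.comap_injective_of_surjective Q.Φ_surjective
    rw [Q.comap_tangent, heq, Submodule.comap_bot, Q.ker_Φ]
  -- (T4) algebraic points, and the hyperplane statement for `M_κ`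
  have h4 : Q.Φ w ∈ Std.Alg L Q.κM := Q.Φ_mem_Alg h₂ h₃ hwAlg
  have h5 := hstd L h₂ h₃ hCM _ _ _ Q.κM W' h1 h2 h3 (Q.Φ w) (Submodule.mem_map_of_mem hwW) h4
  -- (T5) lift the kernel
  obtain ⟨k, hk, hwk⟩ := Q.exists_ker_of_Φ_mem_ker h5
  exact ⟨k, hk, w - k, hwk, by abel⟩

end Transport

end GaGmE

/-- **`analyticSubgroupTheorem_GaGmE` from the hyperplane theorem for the quotients `G/H`** (at
all algebraic points), spelled out as the hypothesis `hH`: the dévissage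
`LiePresentation.linearIndependent_of_hyperplaneTheorem` run in the unrestricted presentation
`GaGmE.pres` — if the coordinates of `u = (x; y; z, t)` (with `exp_G(u)` algebraic) are
`ℚ̄`-linearly dependent and none of the three alternatives holds, `G` is the smallest connected
algebraic subgroup with `u` in its Lie algebra (`GaGmE.SubgroupData.tangent_eq_top_of_mem`),
contradicting the dévissage. Compare `analyticSubgroupTheorem_GaGmE_of_semistabilityTheorem`
(same argument with the semistable dévissage, which needs Thm. 6.15 in every codimension).
[cite: BakerWustholz2007, §6.8 (Thm. 6.1 from Thm. 6.15)] [cite: HuberWustholz2022, Thm. 6.2 (proof)] -/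
theorem analyticSubgroupTheorem_GaGmE_of_hyperplaneTheorem
    (hH : ∀ (L : PeriodPair) (h₂ : IsAlgebraic ℚ L.g₂) (h₃ : IsAlgebraic ℚ L.g₃), ¬ L.HasCM →
      ∀ (ι κ : Type) [Fintype ι] [Fintype κ], (GaGmE.pres L ι κ h₂ h₃).HyperplaneTheorem) :
    analyticSubgroupTheorem_GaGmE := by
  intro L h₂ h₃ hCM ι κ _ _ x y z t hx hy hzt hdep
  classical
  by_contra hcon
  simp only [not_or, not_exists, not_and] at hcon
  obtain ⟨hx0, hny, hnz⟩ := hcon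
  set P := GaGmE.pres L ι κ h₂ h₃ with hP
  have hu : lieCoords x y z t ∈ P.Alg := ⟨hx, hy, hzt⟩
  have hmin : ∀ 𝔥 ∈ P.algLie, lieCoords x y z t ∈ 𝔥 → 𝔥 = ⊤ := by
    rintro _ ⟨D, rfl⟩ huD
    exact D.tangent_eq_top_of_mem hx0 hny hnz huD
  have key := P.linearIndependent_of_hyperplaneTheorem (hH L h₂ h₃ hCM ι κ) hu hmin
  apply hdep
  intro β hβ hsum s
  let β' : Unit ⊕ (ι ⊕ (κ ⊕ κ)) → GaGmE.Kbar := fun s =>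
    ⟨β s, mem_algebraicClosure_iff.mpr (hβ s)⟩
  have hpair : LiePresentation.pair GaGmE.Kbar β' (lieCoords x y z t) = 0 := by
    simpa [LiePresentation.pair, β'] using hsum
  have := congr_fun (key β' hpair) s
  have := congrArg Subtype.val this
  simpa [β'] using this

/-- **`analyticSubgroupTheorem_GaGmE` from the hyperplane case of the Semistability Theorem for
the explicit groups `M_κ` at all algebraic points** (hypothesis `hstd`, as in
`GaGmE.hyperplaneTheorem_pres_of_std_hyperplane`): the exact target left for a Baker-method
discharge of the named fact at non-torsion points.
[cite: BakerWustholz2007, Thm. 6.15, §6.8] -/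
theorem analyticSubgroupTheorem_GaGmE_of_std_hyperplane
    (hstd : ∀ (L : PeriodPair), IsAlgebraic ℚ L.g₂ → IsAlgebraic ℚ L.g₃ → ¬ L.HasCM →
      ∀ (β γ δ : Type) [Fintype β] [Fintype γ] [Fintype δ] (κM : δ → γ → GaGmE.Kbar)
        (W : Submodule ℂ (β ⊕ (γ ⊕ δ) → ℂ)), LiePresentation.IsKRational GaGmE.Kbar W →
        finrank ℂ W + 1 = Fintype.card (β ⊕ (γ ⊕ δ)) →
        (∀ 𝔨 ∈ GaGmE.Std.algLie κM, 𝔨 ≤ W → 𝔨 = ⊥) →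
        ∀ w ∈ W, w ∈ GaGmE.Std.Alg L κM → w ∈ GaGmE.Std.ker L κM) :
    analyticSubgroupTheorem_GaGmE :=
  analyticSubgroupTheorem_GaGmE_of_hyperplaneTheorem
    fun L h₂ h₃ hCM ι κ _ _ => GaGmE.hyperplaneTheorem_pres_of_std_hyperplane hstd L h₂ h₃ hCM ι κ

/-- The hyperplane statement for the `M_κ` at all algebraic points is implied by the unrestricted
named fact `semistabilityTheorem_std` (a hyperplane without non-zero algebraic Lie subalgebras is
proper and semistable: `GaGmE.Std.ne_top_of_hyperplane`, `GaGmE.Std.semistable_of_hyperplane`),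
so the hypothesis of `analyticSubgroupTheorem_GaGmE_of_std_hyperplane` is not stronger than the
tree's existing reduction `analyticSubgroupTheorem_GaGmE_of_std`. [cite: BakerWustholz2007, §6.7, Thm. 6.15] -/
theorem semistabilityTheorem_std.hyperplane (h : semistabilityTheorem_std) :
    ∀ (L : PeriodPair), IsAlgebraic ℚ L.g₂ → IsAlgebraic ℚ L.g₃ → ¬ L.HasCM →
      ∀ (β γ δ : Type) [Fintype β] [Fintype γ] [Fintype δ] (κM : δ → γ → GaGmE.Kbar)
        (W : Submodule ℂ (β ⊕ (γ ⊕ δ) → ℂ)), LiePresentation.IsKRational GaGmE.Kbar W →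
        finrank ℂ W + 1 = Fintype.card (β ⊕ (γ ⊕ δ)) →
        (∀ 𝔨 ∈ GaGmE.Std.algLie κM, 𝔨 ≤ W → 𝔨 = ⊥) →
        ∀ w ∈ W, w ∈ GaGmE.Std.Alg L κM → w ∈ GaGmE.Std.ker L κM :=
  fun L h₂ h₃ hCM β γ δ _ _ _ κM W hWrat hWdim hno w hwW hwAlg =>
    h L h₂ h₃ hCM β γ δ κM W hWrat (GaGmE.Std.ne_top_of_hyperplane hWdim)
      (GaGmE.Std.semistable_of_hyperplane κM hWdim hno) w hwW hwAlg

end Literature.NumberTheory.Transcendental
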